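import Literature.Analysis.FluidPDE.NSVorticity
import Literature.Analysis.FluidPDE.VorticityEquation
import Mathlib.Analysis.SpecialFunctions.SmoothTransition
import HarnessLib

/-!
# Refutation of `isVorticitySolutionOn_iff` (and of `IsVorticitySolutionOn.exists_pressure`)
# in their stated generality

Analysis/FluidPDE support file (refuter cone audit of the named fact
`Literature.Analysis.FluidPDE.isVorticitySolutionOn_iff`, `NSVorticity.lean`, **ns.S34**, and of
its sibling `Literature.Analysis.FluidPDE.IsVorticitySolutionOn.exists_pressure`, `Vorticity.lean`).

The first fact asserts, for **every** time set `S` with `UniqueDiffOn ℝ S` (and every `ν`, `u`),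
that `IsVorticitySolutionOn S ν u ↔ ∃ p, IsClassicalNSSolutionOn S ν 0 u p`; the second is its
direction vorticity ⇒ velocity (`IsVorticitySolutionOn S ν u → UniqueDiffOn ℝ S → ∃ p,
IsClassicalNSSolutionOn S ν 0 u p`, again for every such `S`). Their source (Majda–Bertozzi,
*Vorticity and Incompressible Flow* (2002), §2.4.4 Prop. 2.21 and its proof, §1.4 eq. (1.32))
works on the time interval `[0, ∞)`; the corrected statements on convex time sets are the tree's
`isVorticitySolutionOn_iff_of_convex_holds` and `IsVorticitySolutionOn.exists_pressure_of_convex`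
(`NSVorticityProofs.lean`, both proved). Here we prove that the unrestricted statements are
**false**:

* `not_isVorticitySolutionOn_iff : ¬ ∀ S ν u, (∀ hS : UniqueDiffOn ℝ S,
    IsVorticitySolutionOn S ν u ↔ ∃ p, IsClassicalNSSolutionOn S ν 0 u p)`;
* `not_isVorticitySolutionOn_exists_pressure :
    ¬ ∀ S ν u, (∀ (h : IsVorticitySolutionOn S ν u) (hS : UniqueDiffOn ℝ S),
      ∃ p, IsClassicalNSSolutionOn S ν 0 u p)`;
* `exists_isVorticitySolutionOn_not_exists_pressure`: an explicit time set of unique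
  differentiability carrying an Euler (`ν = 0`) vorticity solution without any classical pressure.

Since 2026-08-15 (D-0026 verdict clean-up: a refuted `def … : Prop` is retired from the named-fact
registry, its `¬`-theorem kept) the four theorems
`VorticityIffCex.not_isVorticitySolutionOn_iff_instance`,
`VorticityIffCex.not_exists_pressure_instance`, `not_isVorticitySolutionOn_iff` and
`not_isVorticitySolutionOn_exists_pressure` state the negated propositions VERBATIM (the `def`
bodies of `isVorticitySolutionOn_iff` and `IsVorticitySolutionOn.exists_pressure`, word for word,
closed over their section-implicit arguments `S ν u`), so that this file does not depend on those
two names and the refuted `def`s can be deleted from `NSVorticity.lean` / `Vorticity.lean` without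
touching the refutation.

## The counterexample (elementary; no Runge approximation)

Time set `S = (-∞, 0] ∪ ⋃ₙ [hₙ, 2hₙ]`, `hₙ = 100⁻ⁿ = αₙ²`, `αₙ = 10⁻ⁿ` — a set of unique
differentiability (every point lies in `(-∞,0]` or in a non-degenerate interval inside `S`) whose
pieces accumulate at `0 ∈ S`. Velocity: on the piece `[hₙ, 2hₙ]`,
`u(t, y) = Vₙ(y) = αₙ n g(n²(y₀² + y₁²)) · (-y₁, y₀, 0)` — a steady, planar, compactly supported
(in the horizontal variables) **Euler swirl** living on the shell `1/n ≤ √(y₀²+y₁²) ≤ 2/n`, with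
centripetal pressure `Pₙ = Ψₙ(y₀² + y₁²)`, `Ψₙ' = φₙ²/2`; and `u = 0` at all other times. Here `g`
is a smooth bump supported in `[1, 4]`, equal to `1` on `[2, 3]`.

1. `u` is `C^∞` *within* `S × ℝ³` (`isSmoothSpaceTimeOn_u`): near pieces and negative times it is
   locally an honest smooth function; at the accumulation time `t = 0` we exhibit the formal Taylor
   series (that of the pieces, zero elsewhere): all derivatives of `Vₙ` are `O(αₙ nᵏ)` and are
   supported on the shell, which keeps distance `≥ 1/n` from any fixed base point for large `n`, so
   every term is `o(|z - z₀|)` within `S × ℝ³` — although `u` admits no `C¹` extension to a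
   neighbourhood of `t = 0`.
2. `u` is divergence free and solves the vorticity formulation with `ν = 0`
   (`isVorticitySolutionOn_u`): all time derivatives within `S` vanish (for fixed `x` the fields are
   eventually constant near every time of `S`), and the steady identity `(V·∇)ω = (ω·∇)V` is read off
   the tree's `isVorticitySolutionOn_of_isOpen` applied to the steady classical solution
   `(Vₙ, Pₙ)` on the time set `univ`.
3. No pressure (`no_pressure`): a classical pressure `p` on `S` has `∇p(t,·) = ∇Pₙ` on the `n`-th
   piece and `∇p(t,·) = 0` for `t ≤ 0`, so `π(t) = p(t, x*) - p(t, 0)`, `x* = (0, 3, 0)`, vanishes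
   for `t ≤ 0` and is `≥ hₙ/2` at `t = hₙ` (the pressure drop across the shell is quadratic in the
   amplitude: `αₙ²/2 · ∫ g² ≥ hₙ/2`), while joint smoothness of `p` within `S × ℝ³` makes `π`
   differentiable within `S` at `0` with derivative `0` (from the left) — contradicting the slopes
   `π(hₙ)/hₙ ≥ 1/2` along `hₙ → 0⁺`.

The mechanism: across the gaps of `S` there is no mean-value theorem in time; the within-`S`
Taylor conditions at `t = 0` only see the amplitude `αₙ` linearly (and the shrinking supports),
whereas the pressure is quadratic in the amplitude. (The module docstring of `NSVorticityProofs`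
sketches a different, potential-flow counterexample resting on Runge's theorem.)

## References

* A. J. Majda, A. L. Bertozzi, *Vorticity and Incompressible Flow* (CUP 2002), §2.4.4 Prop. 2.21 and
  its proof (p. 70 of the held text), §1.4 eq. (1.32): the source of the fact, on `[0, ∞)`.
* The tree: `NSVorticity.lean` / `Vorticity.lean` (homes of the two retired facts),
  `NSVorticityProofs.lean` (corrected statements, proved),
  `VorticityEquation.lean` (`isVorticitySolutionOn_of_isOpen`), `VorticityCalculus.lean`
  (`curl_zero`, `curl_eq_zero_of_notMem_tsupport`).
-/

noncomputable section

open Set Function Filter InnerProductSpace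
open _root_.Topology
open scoped RealInnerProductSpace Laplacian ContDiff

namespace Literature.Analysis.FluidPDE

namespace VorticityIffCex

/-- Local notation for physical space `ℝ³ = EuclideanSpace ℝ (Fin 3)`. -/
local notation "ℝ³" => EuclideanSpace ℝ (Fin 3)

/-! ### The radial profile -/

/-- A smooth bump `g : ℝ → [0,1]` supported in `[1,4]`, equal to `1` on `[2,3]`. [folklore] -/
def g (s : ℝ) : ℝ := Real.smoothTransition (s - 1) * Real.smoothTransition (4 - s)

/-- The bump `g` is smooth. [folklore] -/
theorem g_contDiff : ContDiff ℝ ∞ g :=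
  (Real.smoothTransition.contDiff.comp (contDiff_id.sub contDiff_const)).mul
    (Real.smoothTransition.contDiff.comp (contDiff_const.sub contDiff_id))

/-- The bump `g` is continuous. [folklore] -/
theorem g_continuous : Continuous g := g_contDiff.continuous

/-- The bump `g` is nonnegative. [folklore] -/
theorem g_nonneg (s : ℝ) : 0 ≤ g s :=
  mul_nonneg (Real.smoothTransition.nonneg _) (Real.smoothTransition.nonneg _)

/-- The bump `g` is at most `1`. [folklore] -/
theorem g_le_one (s : ℝ) : g s ≤ 1 :=
  mul_le_one₀ (Real.smoothTransition.le_one _) (Real.smoothTransition.nonneg _)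
    (Real.smoothTransition.le_one _)

/-- `g` vanishes on `(-∞, 1]`. [folklore] -/
theorem g_eq_zero_of_le_one {s : ℝ} (hs : s ≤ 1) : g s = 0 := by
  simp [g, Real.smoothTransition.zero_of_nonpos (sub_nonpos.2 hs)]

/-- `g` vanishes on `[4, ∞)`. [folklore] -/
theorem g_eq_zero_of_four_le {s : ℝ} (hs : 4 ≤ s) : g s = 0 := by
  simp [g, Real.smoothTransition.zero_of_nonpos (sub_nonpos.2 hs)]

/-- `g = 1` on `[2, 3]`. [folklore] -/
theorem g_eq_one_of_mem {s : ℝ} (hs : s ∈ Icc (2 : ℝ) 3) : g s = 1 := by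
  rw [g, Real.smoothTransition.one_of_one_le (by linarith [hs.1]),
    Real.smoothTransition.one_of_one_le (by linarith [hs.2]), one_mul]

/-- `g s ≠ 0` forces `1 < s < 4`. [folklore] -/
theorem g_ne_zero_imp {s : ℝ} (hs : g s ≠ 0) : 1 < s ∧ s < 4 :=
  ⟨not_le.1 fun h => hs (g_eq_zero_of_le_one h), not_le.1 fun h => hs (g_eq_zero_of_four_le h)⟩

/-! ### Coordinates, the rotation `W`, the horizontal projection `ρ` -/

/-- The basis vector `eᵢ = EuclideanSpace.single i 1` (a `simp`-reducible abbreviation). [folklore] -/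
@[simp] def e (i : Fin 3) : ℝ³ := EuclideanSpace.single i 1

/-- `W y = (-y₁, y₀, 0)`: rotation by `π/2` in the horizontal plane, killing the vertical part. [folklore] -/
def W : ℝ³ →L[ℝ] ℝ³ :=
  (EuclideanSpace.proj 0).smulRight (e 1) - (EuclideanSpace.proj 1).smulRight (e 0)

/-- `ρ y = (y₀, y₁, 0)`: the horizontal projection. [folklore] -/
def ρ : ℝ³ →L[ℝ] ℝ³ :=
  (EuclideanSpace.proj 0).smulRight (e 0) + (EuclideanSpace.proj 1).smulRight (e 1)

/-- `q y = y₀² + y₁²`, the squared distance to the vertical axis. [folklore] -/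
def q (y : ℝ³) : ℝ := y 0 ^ 2 + y 1 ^ 2

/-- The derivative of `q`: `dq y h = 2 y₀ h₀ + 2 y₁ h₁`. [folklore] -/
def dq (y : ℝ³) : ℝ³ →L[ℝ] ℝ := (2 * y 0) • EuclideanSpace.proj 0 + (2 * y 1) • EuclideanSpace.proj 1

/-- Coordinates of `W y = (-y₁, y₀, 0)`. [folklore] -/
@[simp] theorem W_apply (y : ℝ³) (i : Fin 3) :
    W y i = y 0 * (e 1) i - y 1 * (e 0) i := by
  simp [W]

/-- Coordinates of `ρ y = (y₀, y₁, 0)`. [folklore] -/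
@[simp] theorem ρ_apply (y : ℝ³) (i : Fin 3) :
    ρ y i = y 0 * (e 0) i + y 1 * (e 1) i := by
  simp [ρ]

/-- `dq y h = 2 y₀ h₀ + 2 y₁ h₁`. [folklore] -/
@[simp] theorem dq_apply (y h : ℝ³) : dq y h = 2 * y 0 * h 0 + 2 * y 1 * h 1 := by
  simp [dq]

/-- The rotation `W y` is tangent to the level sets of `q`: `dq y (W y) = 0`. [folklore] -/
theorem dq_W (y : ℝ³) : dq y (W y) = 0 := by
  simp; ring

/-- `W (W y) = -(y₀, y₁, 0)`: rotating twice by `π/2` negates the horizontal part. [folklore] -/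
theorem W_W (y : ℝ³) : W (W y) = -ρ y := by
  ext i; fin_cases i <;> simp

/-- Unfolding `q`. [folklore] -/
theorem q_eq (y : ℝ³) : q y = y 0 ^ 2 + y 1 ^ 2 := rfl

/-- The derivative of `q` is `dq`. [folklore] -/
theorem hasFDerivAt_q (y : ℝ³) : HasFDerivAt q (dq y) y := by
  have h0 : HasFDerivAt (fun y : ℝ³ => y 0) (EuclideanSpace.proj (𝕜 := ℝ) (0 : Fin 3)) y :=
    (EuclideanSpace.proj (𝕜 := ℝ) (0 : Fin 3)).hasFDerivAt
  have h1 : HasFDerivAt (fun y : ℝ³ => y 1) (EuclideanSpace.proj (𝕜 := ℝ) (1 : Fin 3)) y :=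
    (EuclideanSpace.proj (𝕜 := ℝ) (1 : Fin 3)).hasFDerivAt
  have hq : q = fun y : ℝ³ => y 0 * y 0 + y 1 * y 1 := by
    funext y; simp only [q]; ring
  rw [hq]
  refine ((h0.mul h0).add (h1.mul h1)).congr_fderiv ?_
  ext h
  simp [dq]
  ring

/-- `q` is smooth (a polynomial in the coordinates). [folklore] -/
theorem q_contDiff : ContDiff ℝ ∞ q := by
  unfold q
  fun_prop

/-- `q ≥ 0`. [folklore] -/
theorem q_nonneg (y : ℝ³) : 0 ≤ q y := by unfold q; positivity

/-- `|ρ y|² = q y`. [folklore] -/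
theorem norm_ρ_sq (y : ℝ³) : ‖ρ y‖ ^ 2 = q y := by
  rw [EuclideanSpace.real_norm_sq_eq, Fin.sum_univ_three]
  simp [q]

/-- The horizontal projection does not increase the norm. [folklore] -/
theorem norm_ρ_le (y : ℝ³) : ‖ρ y‖ ≤ ‖y‖ := by
  have h1 : ‖ρ y‖ ^ 2 ≤ ‖y‖ ^ 2 := by
    rw [norm_ρ_sq, EuclideanSpace.real_norm_sq_eq, Fin.sum_univ_three, q]
    nlinarith [sq_nonneg (y 2)]
  exact (pow_le_pow_iff_left₀ (norm_nonneg _) (norm_nonneg _) two_ne_zero).1 h1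


/-! ### The swirl with radial profile `φ` -/

/-- The planar swirl `V φ y = φ (q y) • (-y₁, y₀, 0)`. [folklore] -/
def V (φ : ℝ → ℝ) (y : ℝ³) : ℝ³ := φ (q y) • W y

/-- Unfolding the swirl. [folklore] -/
theorem V_apply (φ : ℝ → ℝ) (y : ℝ³) : V φ y = φ (q y) • W y := rfl

/-- The swirl with a smooth profile is smooth. [folklore] -/
theorem contDiff_V {φ : ℝ → ℝ} (hφ : ContDiff ℝ ∞ φ) : ContDiff ℝ ∞ (V φ) :=
  (hφ.comp q_contDiff).smul W.contDiff

/-- The derivative of the swirl: `D(V φ)(y) = φ(q y) W + (φ'(q y) dq y) ⊗ W y`. [folklore] -/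
theorem hasFDerivAt_V {φ : ℝ → ℝ} (hφ : ContDiff ℝ ∞ φ) (y : ℝ³) :
    HasFDerivAt (V φ) (φ (q y) • W + (deriv φ (q y) • dq y).smulRight (W y)) y := by
  have h1 : HasFDerivAt (fun y => φ (q y)) (deriv φ (q y) • dq y) y :=
    ((hφ.differentiable (by simp)) (q y)).hasDerivAt.comp_hasFDerivAt y (hasFDerivAt_q y)
  exact h1.smul W.hasFDerivAt

/-- The swirl is differentiable. [folklore] -/
theorem differentiable_V {φ : ℝ → ℝ} (hφ : ContDiff ℝ ∞ φ) : Differentiable ℝ (V φ) :=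
  (contDiff_V hφ).differentiable (by simp)

/-- The centripetal acceleration of the swirl: `(V·∇)V = -φ(q)² (y₀, y₁, 0)`. [folklore] -/
theorem convect_V {φ : ℝ → ℝ} (hφ : ContDiff ℝ ∞ φ) (y : ℝ³) :
    convect (V φ) (V φ) y = -((φ (q y)) ^ 2 • ρ y) := by
  rw [convect_apply, (hasFDerivAt_V hφ y).fderiv]
  ext i
  fin_cases i <;> simp [V_apply] <;> ring

/-- The swirl is divergence free. [folklore] -/
theorem divergence_V {φ : ℝ → ℝ} (hφ : ContDiff ℝ ∞ φ) (y : ℝ³) :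
    VectorCalculus.divergence (V φ) y = 0 := by
  rw [divergence_eq_sum_inner_fderiv (EuclideanSpace.basisFun (Fin 3) ℝ), (hasFDerivAt_V hφ y).fderiv,
    Fin.sum_univ_three]
  simp [EuclideanSpace.basisFun_apply, EuclideanSpace.inner_single_left]
  ring

/-- The swirl is divergence free (as a predicate). [folklore] -/
theorem isDivFree_V {φ : ℝ → ℝ} (hφ : ContDiff ℝ ∞ φ) : VectorCalculus.IsDivFree (V φ) :=
  fun y => divergence_V hφ y

/-- The pressure of the swirl: `∇(Ψ ∘ q) = φ(q)² (y₀, y₁, 0)` when `Ψ' = φ²/2`. [folklore] -/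
theorem hasGradientAt_P {φ Ψ : ℝ → ℝ} (hΨ' : ∀ s, HasDerivAt Ψ ((φ s) ^ 2 / 2) s) (y : ℝ³) :
    HasGradientAt (fun y => Ψ (q y)) ((φ (q y)) ^ 2 • ρ y) y := by
  rw [hasGradientAt_iff_hasFDerivAt]
  have h1 : HasFDerivAt (fun y => Ψ (q y)) (((φ (q y)) ^ 2 / 2) • dq y) y :=
    (hΨ' (q y)).comp_hasFDerivAt y (hasFDerivAt_q y)
  refine h1.congr_fderiv ?_
  ext h
  simp [toDual_apply_apply, PiLp.inner_apply, Fin.sum_univ_three]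
  ring

/-- The gradient of the centripetal pressure `Ψ ∘ q` is `φ(q)² (y₀, y₁, 0)` when `Ψ' = φ²/2`. [folklore] -/
theorem gradient_P {φ Ψ : ℝ → ℝ} (hΨ' : ∀ s, HasDerivAt Ψ ((φ s) ^ 2 / 2) s) (y : ℝ³) :
    gradient (fun y => Ψ (q y)) y = (φ (q y)) ^ 2 • ρ y :=
  (hasGradientAt_P hΨ' y).gradient

/-- The steady swirl with its centripetal pressure is a classical Euler solution on every time set. [folklore] -/
theorem steady_isClassical {φ Ψ : ℝ → ℝ} (hφ : ContDiff ℝ ∞ φ) (hΨ : ContDiff ℝ ∞ Ψ)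
    (hΨ' : ∀ s, HasDerivAt Ψ ((φ s) ^ 2 / 2) s) (S : Set ℝ) :
    IsClassicalNSSolutionOn S 0 0 (fun _ => V φ) (fun _ y => Ψ (q y)) where
  smooth_velocity := ((contDiff_V hφ).comp contDiff_snd).contDiffOn
  smooth_pressure := ((hΨ.comp q_contDiff).comp contDiff_snd).contDiffOn
  momentum t ht y := by
    simp only [timeDerivWithin_apply, derivWithin_fun_const, zero_smul, zero_sub,
      Pi.zero_apply, add_zero, zero_add]
    rw [convect_V hφ, gradient_P hΨ']
  divFree t ht := isDivFree_V hφ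

/-- The vorticity identity `(V·∇)ω = (ω·∇)V` of the steady swirl (from the tree's
`isVorticitySolutionOn_of_isOpen` on the time set `univ`; no curl is computed). [folklore] -/
theorem convect_curl_V {φ Ψ : ℝ → ℝ} (hφ : ContDiff ℝ ∞ φ) (hΨ : ContDiff ℝ ∞ Ψ)
    (hΨ' : ∀ s, HasDerivAt Ψ ((φ s) ^ 2 / 2) s) (x : ℝ³) :
    convect (V φ) (curl (V φ)) x = convect (curl (V φ)) (V φ) x + (0 : ℝ) • (Δ (curl (V φ))) x := by
  have h := (steady_isClassical hφ hΨ hΨ' univ).isVorticitySolutionOn_of_isOpen isOpen_univ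
    (fun t _ y => by rw [Pi.zero_apply]; exact curl_zero y)
  have e := h.vorticity_eq 0 (mem_univ _) x
  simpa only [timeDerivWithin_apply, vorticity_apply, derivWithin_fun_const, Pi.zero_apply,
    zero_add] using e

/-! ### The radial profiles: amplitudes, the base bump and its primitive -/

/-- `Φ σ = ∫₀^σ g²`, a primitive of `g²`. [folklore] -/
def Φ (σ : ℝ) : ℝ := ∫ τ in (0 : ℝ)..σ, (g τ) ^ 2

/-- `Φ' = g²` (fundamental theorem of calculus for the continuous integrand `g²`). [folklore] -/
theorem hasDerivAt_Φ (σ : ℝ) : HasDerivAt Φ ((g σ) ^ 2) σ :=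
  ((g_continuous.pow 2).integral_hasStrictDerivAt 0 σ).hasDerivAt

/-- `deriv Φ = g²`. [folklore] -/
theorem deriv_Φ : deriv Φ = fun σ => (g σ) ^ 2 :=
  funext fun σ => (hasDerivAt_Φ σ).deriv

/-- `Φ` is smooth (its derivative `g²` is). [folklore] -/
theorem Φ_contDiff : ContDiff ℝ ∞ Φ := by
  rw [contDiff_infty_iff_deriv, deriv_Φ]
  exact ⟨fun σ => (hasDerivAt_Φ σ).differentiableAt, g_contDiff.pow 2⟩

/-- `Φ σ ≥ ∫₂³ g² = 1` for `σ ≥ 3` (monotonicity of the integral of `g² ≥ 0`, and `g = 1` on `[2,3]`). [folklore] -/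
theorem one_le_Φ {σ : ℝ} (hσ : 3 ≤ σ) : 1 ≤ Φ σ := by
  have h1 : ∫ τ in (2 : ℝ)..3, (g τ) ^ 2 = 1 := by
    have : ∫ τ in (2 : ℝ)..3, (g τ) ^ 2 = ∫ τ in (2 : ℝ)..3, (1 : ℝ) := by
      refine intervalIntegral.integral_congr fun τ hτ => ?_
      rw [uIcc_of_le (by norm_num : (2 : ℝ) ≤ 3)] at hτ
      simp [g_eq_one_of_mem hτ]
    rw [this, intervalIntegral.integral_const]
    norm_num
  rw [← h1, Φ]
  refine intervalIntegral.integral_mono_interval (by norm_num) (by norm_num) hσ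
    (Filter.Eventually.of_forall fun τ => sq_nonneg _) ?_
  exact (g_continuous.pow 2).intervalIntegrable _ _

/-- `Φ 0 = 0`. [folklore] -/
theorem Φ_zero : Φ 0 = 0 := by simp [Φ]

/-- amplitudes `α n = 10⁻ⁿ`, time scales `h n = α n ^ 2 = 100⁻ⁿ` [folklore] -/
def α (n : ℕ) : ℝ := (1 / 10) ^ n

/-- The time scales `h n = 100⁻ⁿ` (`= (α n)²`). [folklore] -/
def h (n : ℕ) : ℝ := (1 / 100) ^ n

/-- `α n > 0`. [folklore] -/
theorem α_pos (n : ℕ) : 0 < α n := by unfold α; positivity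

/-- `h n > 0`. [folklore] -/
theorem h_pos (n : ℕ) : 0 < h n := by unfold h; positivity

/-- `(α n)² = h n`: the time scale matches the (quadratic) pressure scale. [folklore] -/
theorem α_sq (n : ℕ) : α n ^ 2 = h n := by
  unfold α h; rw [← pow_mul, mul_comm, pow_mul]; norm_num

/-- `h (n+1) = h n / 100`. [folklore] -/
theorem h_succ (n : ℕ) : h (n + 1) = h n / 100 := by
  unfold h; rw [pow_succ]; ring

/-- The time scales decrease strictly. [folklore] -/
theorem h_anti : StrictAnti h := by
  refine strictAnti_nat_of_succ_lt fun n => ?_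
  rw [h_succ]; have := h_pos n; linarith

/-- profile `n`: `φ n s = α n * n * g (n² s)`, pressure profile `Ψ n s = α n ^ 2 / 2 * Φ (n² s)`. [folklore] -/
def φ (n : ℕ) (s : ℝ) : ℝ := α n * n * g (n ^ 2 * s)

/-- The pressure profile of piece `n`: `Ψ n s = (α n)² / 2 · Φ (n² s)`, a primitive of `(φ n)²/2`. [folklore] -/
def Ψ (n : ℕ) (s : ℝ) : ℝ := α n ^ 2 / 2 * Φ (n ^ 2 * s)

/-- The velocity profile of piece `n` is smooth. [folklore] -/
theorem φ_contDiff (n : ℕ) : ContDiff ℝ ∞ (φ n) :=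
  contDiff_const.mul (g_contDiff.comp (contDiff_const.mul contDiff_id))

/-- The pressure profile of piece `n` is smooth. [folklore] -/
theorem Ψ_contDiff (n : ℕ) : ContDiff ℝ ∞ (Ψ n) :=
  contDiff_const.mul (Φ_contDiff.comp (contDiff_const.mul contDiff_id))

/-- `(Ψ n)' = (φ n)² / 2`. [folklore] -/
theorem hasDerivAt_Ψ (n : ℕ) (s : ℝ) : HasDerivAt (Ψ n) ((φ n s) ^ 2 / 2) s := by
  have h1 : HasDerivAt (fun s => (n : ℝ) ^ 2 * s) ((n : ℝ) ^ 2) s := by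
    simpa using (hasDerivAt_id s).const_mul ((n : ℝ) ^ 2)
  have h2 : HasDerivAt (fun s => Φ ((n : ℝ) ^ 2 * s)) ((g ((n : ℝ) ^ 2 * s)) ^ 2 * (n : ℝ) ^ 2) s :=
    (hasDerivAt_Φ _).comp s h1
  have h3 := h2.const_mul (α n ^ 2 / 2)
  have heq : α n ^ 2 / 2 * ((g ((n : ℝ) ^ 2 * s)) ^ 2 * (n : ℝ) ^ 2) = (φ n s) ^ 2 / 2 := by
    unfold φ; ring
  rw [← heq]
  exact h3

/-- The velocity of piece `n` and its pressure. [folklore] -/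
def Vn (n : ℕ) : ℝ³ → ℝ³ := V (φ n)

/-- The centripetal pressure of piece `n`, `Pn n y = Ψ n (q y)`. [folklore] -/
def Pn (n : ℕ) (y : ℝ³) : ℝ := Ψ n (q y)

/-- **The pressure drop of piece `n`** between the axis and `x* = (0, 3, 0)` is at least `h n / 2` (for `n ≥ 1`): `Pn n x* - Pn n 0 = (α n)²/2 · Φ(9n²) ≥ (α n)²/2 · ∫₂³ g² = h n / 2`. [folklore] -/
theorem Pn_star_sub_Pn_zero (n : ℕ) (hn : 1 ≤ n) :
    h n / 2 ≤ Pn n (EuclideanSpace.single 1 3) - Pn n 0 := by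
  have hq1 : q (EuclideanSpace.single (1 : Fin 3) (3 : ℝ)) = 9 := by
    simp [q]; norm_num
  have hq0 : q (0 : ℝ³) = 0 := by simp [q]
  simp only [Pn, Ψ, hq1, hq0, mul_zero, Φ_zero, sub_zero]
  have hn' : (1 : ℝ) ≤ n := by exact_mod_cast hn
  have h9 : (3 : ℝ) ≤ (n : ℝ) ^ 2 * 9 := by nlinarith
  have := one_le_Φ h9
  rw [← α_sq]
  nlinarith [sq_nonneg (α n)]

/-! ### The time set `S = (-∞, 0] ∪ ⋃ₙ [hₙ, 2hₙ]` -/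

/-- The `n`-th time piece `[hₙ, 2hₙ]`. [folklore] -/
def piece (n : ℕ) : Set ℝ := Icc (h n) (2 * h n)

/-- The time set of the counterexample. [folklore] -/
def S : Set ℝ := Iic 0 ∪ ⋃ n, piece n

/-- Membership in a piece. [folklore] -/
theorem mem_piece {n : ℕ} {t : ℝ} : t ∈ piece n ↔ h n ≤ t ∧ t ≤ 2 * h n := Iff.rfl

/-- The left endpoint `h n` lies on piece `n`. [folklore] -/
theorem h_mem_piece (n : ℕ) : h n ∈ piece n := ⟨le_rfl, by linarith [h_pos n]⟩

/-- Every piece is part of the time set. [folklore] -/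
theorem piece_subset_S (n : ℕ) : piece n ⊆ S :=
  subset_union_of_subset_right (subset_iUnion piece n) _

/-- The accumulation time `0` belongs to `S`. [folklore] -/
theorem zero_mem_S : (0 : ℝ) ∈ S := Or.inl (show (0 : ℝ) ≤ 0 from le_rfl)

/-- Pieces consist of positive times. [folklore] -/
theorem piece_pos {n : ℕ} {t : ℝ} (ht : t ∈ piece n) : 0 < t := (h_pos n).trans_le ht.1

/-- `h n ≤ h m / 100` for `m < n`. [folklore] -/
theorem h_le_of_lt {m n : ℕ} (hmn : m < n) : h n ≤ h m / 100 := by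
  have := h_anti.antitone (Nat.succ_le_of_lt hmn)
  rwa [h_succ] at this

/-- **`S` is a set of unique differentiability**: every point lies in `(-∞, 0]` or in a non-degenerate closed interval contained in `S`. [folklore] -/
theorem uniqueDiffOn_S : UniqueDiffOn ℝ S := by
  intro t ht
  rcases ht with ht | ht
  · exact (uniqueDiffOn_Iic 0 t ht).mono subset_union_left
  · obtain ⟨n, hn⟩ := mem_iUnion.1 ht
    have hlt : h n < 2 * h n := by linarith [h_pos n]
    exact (uniqueDiffOn_Icc hlt t hn).mono (piece_subset_S n)

/-- The pieces are pairwise disjoint. [folklore] -/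
theorem piece_unique {m n : ℕ} {t : ℝ} (hm : t ∈ piece m) (hn : t ∈ piece n) : m = n := by
  by_contra hne
  rcases lt_or_gt_of_ne hne with hmn | hnm
  · have := h_le_of_lt hmn
    linarith [hm.1, hn.2, h_pos m]
  · have := h_le_of_lt hnm
    linarith [hn.1, hm.2, h_pos n]

/-- A time of `S` is non-positive or lies on a piece. [folklore] -/
theorem mem_S_cases {t : ℝ} (ht : t ∈ S) : t ≤ 0 ∨ ∃ n, t ∈ piece n := by
  rcases ht with ht | ht
  · exact Or.inl ht
  · exact Or.inr (mem_iUnion.1 ht)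

/-- A positive time of `S` lies on a piece. [folklore] -/
theorem exists_piece_of_pos {t : ℝ} (ht : t ∈ S) (hpos : 0 < t) : ∃ n, t ∈ piece n :=
  (mem_S_cases ht).resolve_left (not_le.2 hpos)

/-- Non-positive times lie on no piece. [folklore] -/
theorem not_mem_piece_of_nonpos {t : ℝ} (ht : t ≤ 0) (n : ℕ) : t ∉ piece n :=
  fun hn => (lt_irrefl (0 : ℝ)) ((piece_pos hn).trans_le ht)

/-- Isolation of the pieces inside `S`. [folklore] -/
theorem piece_isolated {n : ℕ} {t t' : ℝ} (ht : t ∈ piece n) (ht' : t' ∈ S)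
    (hd : |t' - t| < h n / 2) : t' ∈ piece n := by
  have hd1 := (abs_lt.1 hd).1
  have hd2 := (abs_lt.1 hd).2
  rcases mem_S_cases ht' with h0 | ⟨m, hm⟩
  · exfalso; linarith [ht.1, h_pos n]
  · rcases lt_trichotomy n m with hnm | rfl | hmn
    · exfalso
      have := h_le_of_lt hnm
      linarith [ht.1, hm.2, h_pos n]
    · exact hm
    · exfalso
      have := h_le_of_lt hmn
      linarith [hm.1, ht.2, h_pos n]

/-- A point of a piece below `h N` lies on a piece with index `> N`. [folklore] -/
theorem lt_of_mem_piece_of_lt {n N : ℕ} {t : ℝ} (ht : t ∈ piece n) (htN : t < h N) : N < n := by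
  by_contra hle
  push Not at hle
  have := h_anti.antitone hle
  linarith [ht.1]

/-! ### The velocity field -/

open Classical in
/-- The velocity: the swirl `Vn n` on the piece `[hₙ, 2hₙ]`, zero at all other times. [folklore] -/
def u (t : ℝ) : ℝ³ → ℝ³ :=
  if ht : ∃ n, t ∈ piece n then Vn (Classical.choose ht) else 0

/-- On piece `n` the velocity is the swirl `Vn n`. [folklore] -/
theorem u_of_mem {n : ℕ} {t : ℝ} (ht : t ∈ piece n) : u t = Vn n := by
  have hex : ∃ m, t ∈ piece m := ⟨n, ht⟩
  rw [u, dif_pos hex, piece_unique (Classical.choose_spec hex) ht]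

/-- Off the pieces the velocity vanishes. [folklore] -/
theorem u_of_not {t : ℝ} (ht : ∀ n, t ∉ piece n) : u t = 0 := by
  rw [u, dif_neg (by push Not; exact ht)]

/-- At non-positive times the velocity vanishes. [folklore] -/
theorem u_of_nonpos {t : ℝ} (ht : t ≤ 0) : u t = 0 :=
  u_of_not (not_mem_piece_of_nonpos ht)

/-- The velocity of piece `n` vanishes off the shell `1 ≤ n² q ≤ 4`. [folklore] -/
theorem tsupport_Vn_subset (n : ℕ) :
    tsupport (Vn n) ⊆ {y | 1 ≤ (n : ℝ) ^ 2 * q y ∧ (n : ℝ) ^ 2 * q y ≤ 4} := by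
  refine closure_minimal (fun y hy => ?_) ?_
  · have hg : g ((n : ℝ) ^ 2 * q y) ≠ 0 := by
      intro h0
      apply hy
      simp [Vn, V_apply, φ, h0]
    obtain ⟨h1, h4⟩ := g_ne_zero_imp hg
    exact ⟨h1.le, h4.le⟩
  · have hc : Continuous fun y : ℝ³ => (n : ℝ) ^ 2 * q y :=
      continuous_const.mul q_contDiff.continuous
    exact isClosed_Icc.preimage hc

/-- For every fixed point `x`, eventually (in `n`) `x` is off the support of `Vn n`. [folklore] -/
theorem eventually_notMem_tsupport_Vn (x : ℝ³) : ∃ N : ℕ, ∀ n, N ≤ n → x ∉ tsupport (Vn n) := by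
  by_cases hq : q x = 0
  · refine ⟨0, fun n _ hx => ?_⟩
    have := (tsupport_Vn_subset n hx).1
    rw [hq, mul_zero] at this
    linarith
  · have hqpos : 0 < q x := lt_of_le_of_ne (q_nonneg x) (Ne.symm hq)
    obtain ⟨N, hN⟩ := exists_nat_gt (4 / q x)
    refine ⟨N, fun n hn hx => ?_⟩
    have h4 := (tsupport_Vn_subset n hx).2
    have hN' : 4 / q x < n := hN.trans_le (by exact_mod_cast hn)
    rw [div_lt_iff₀ hqpos] at hN'
    have hn0 : n ≠ 0 := by
      rintro rfl
      norm_num at hN'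
    have hn1 : (1 : ℝ) ≤ n := by exact_mod_cast Nat.one_le_iff_ne_zero.2 hn0
    have key : (n : ℝ) * q x ≤ (n : ℝ) ^ 2 * q x := by
      have : 0 ≤ ((n : ℝ) - 1) * ((n : ℝ) * q x) :=
        mul_nonneg (sub_nonneg.2 hn1) (mul_nonneg (Nat.cast_nonneg n) hqpos.le)
      nlinarith
    linarith

/-- Near a time `t ∈ S`, for a fixed point `x`: the velocity and the vorticity at `x` are
eventually (within `S`) equal to their values at `t`. [folklore] -/
theorem eventually_eq_within {t : ℝ} (ht : t ∈ S) (x : ℝ³) :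
    (∀ᶠ s in 𝓝[S] t, u s x = u t x) ∧ (∀ᶠ s in 𝓝[S] t, curl (u s) x = curl (u t) x) := by
  rcases lt_trichotomy t 0 with hneg | rfl | hpos
  · have hev : ∀ᶠ s in 𝓝[S] t, u s = u t := by
      filter_upwards [mem_nhdsWithin_of_mem_nhds (Iio_mem_nhds hneg)] with s hs
      rw [u_of_nonpos (le_of_lt hs), u_of_nonpos hneg.le]
    exact ⟨hev.mono fun s hs => by rw [hs], hev.mono fun s hs => by rw [hs]⟩
  · obtain ⟨N, hN⟩ := eventually_notMem_tsupport_Vn x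
    have hev : ∀ᶠ s in 𝓝[S] (0 : ℝ), x ∉ tsupport (u s) := by
      have hm : Iio (h N) ∈ 𝓝 (0 : ℝ) := Iio_mem_nhds (h_pos N)
      filter_upwards [inter_mem_nhdsWithin S hm] with s ⟨hsS, hsN⟩
      rcases mem_S_cases hsS with hs0 | ⟨n, hn⟩
      · rw [u_of_nonpos hs0]; simp
      · rw [u_of_mem hn]
        exact hN n (lt_of_mem_piece_of_lt hn hsN).le
    rw [u_of_nonpos le_rfl]
    refine ⟨hev.mono fun s hs => ?_, hev.mono fun s hs => ?_⟩
    · rw [image_eq_zero_of_notMem_tsupport hs]; rfl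
    · rw [curl_eq_zero_of_notMem_tsupport hs, curl_zero]
  · obtain ⟨n, hn⟩ := exists_piece_of_pos ht hpos
    have hev : ∀ᶠ s in 𝓝[S] t, u s = u t := by
      have hm : Ioo (t - h n / 2) (t + h n / 2) ∈ 𝓝 t :=
        Ioo_mem_nhds (by linarith [h_pos n]) (by linarith [h_pos n])
      filter_upwards [inter_mem_nhdsWithin S hm] with s ⟨hsS, hs⟩
      have habs : |s - t| < h n / 2 := abs_lt.2 ⟨by linarith [hs.1], by linarith [hs.2]⟩
      rw [u_of_mem (piece_isolated hn hsS habs), u_of_mem hn]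
    exact ⟨hev.mono fun s hs => by rw [hs], hev.mono fun s hs => by rw [hs]⟩

/-- A function eventually constant within `s` near `t` has `derivWithin f s t = 0` (at a point of unique differentiability). [folklore] -/
theorem derivWithin_eq_zero_of_eventually {β : Type*} [NormedAddCommGroup β] [NormedSpace ℝ β]
    {f : ℝ → β} {s : Set ℝ} {t : ℝ} (hs : UniqueDiffWithinAt ℝ s t)
    (hf : ∀ᶠ τ in 𝓝[s] t, f τ = f t) : derivWithin f s t = 0 :=
  ((hasDerivWithinAt_const t s (f t)).congr_of_eventuallyEq hf rfl).derivWithin hs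

/-- **The time derivative of the velocity within `S` vanishes identically** (pointwise in `x`). [folklore] -/
theorem derivWithin_u_eq_zero {t : ℝ} (ht : t ∈ S) (x : ℝ³) :
    derivWithin (fun s => u s x) S t = 0 :=
  derivWithin_eq_zero_of_eventually (uniqueDiffOn_S t ht) (eventually_eq_within ht x).1

/-- **The time derivative of the vorticity within `S` vanishes identically** (pointwise in `x`). [folklore] -/
theorem derivWithin_curl_u_eq_zero {t : ℝ} (ht : t ∈ S) (x : ℝ³) :
    derivWithin (fun s => curl (u s) x) S t = 0 :=
  derivWithin_eq_zero_of_eventually (uniqueDiffOn_S t ht) (eventually_eq_within ht x).2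

/-- The velocity is divergence free at all times. [folklore] -/
theorem isDivFree_u (t : ℝ) : VectorCalculus.IsDivFree (u t) := by
  by_cases hex : ∃ n, t ∈ piece n
  · obtain ⟨n, hn⟩ := hex
    rw [u_of_mem hn]
    exact isDivFree_V (φ_contDiff n)
  · push Not at hex
    rw [u_of_not hex]
    intro x
    simp [VectorCalculus.divergence]

/-! ### Bounds on the iterated derivatives of the pieces -/

/-- Local notation for the plane `ℝ² = EuclideanSpace ℝ (Fin 2)`. -/
local notation "ℝ²" => EuclideanSpace ℝ (Fin 2)

/-- The space-time representative of piece `n`: `F n (t, y) = Vn n y`. [folklore] -/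
def F (n : ℕ) (z : ℝ × ℝ³) : ℝ³ := Vn n z.2

/-- The space-time representative of piece `n` is smooth on all of `ℝ × ℝ³`. [folklore] -/
theorem F_contDiff (n : ℕ) : ContDiff ℝ ∞ (F n) :=
  (contDiff_V (φ_contDiff n)).comp contDiff_snd

/-- The basis vector `eᵢ = EuclideanSpace.single i 1` of the plane (`simp`-reducible). [folklore] -/
@[simp] def e₂ (i : Fin 2) : ℝ² := EuclideanSpace.single i 1

/-- `W₂ v = (-v₁, v₀, 0)`. [folklore] -/
def W₂ : ℝ² →L[ℝ] ℝ³ :=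
  (EuclideanSpace.proj 0).smulRight (e 1) - (EuclideanSpace.proj 1).smulRight (e 0)

/-- Coordinates of `W₂ v = (-v₁, v₀, 0)`. [folklore] -/
@[simp] theorem W₂_apply (v : ℝ²) (i : Fin 3) : W₂ v i = v 0 * (e 1) i - v 1 * (e 0) i := by
  simp [W₂]

/-- The compactly supported planar profile `F₂ v = g (|v|²) • (-v₁, v₀, 0)`. [folklore] -/
def F₂ (v : ℝ²) : ℝ³ := g (v 0 ^ 2 + v 1 ^ 2) • W₂ v

/-- The planar profile is smooth. [folklore] -/
theorem F₂_contDiff : ContDiff ℝ ∞ F₂ := by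
  unfold F₂
  refine ContDiff.smul (g_contDiff.comp ?_) W₂.contDiff
  fun_prop

/-- The horizontal coordinates of a space-time point, `P₂ (t, y) = (y₀, y₁)`. [folklore] -/
def P₂ : ℝ × ℝ³ →L[ℝ] ℝ² :=
  ((EuclideanSpace.proj 0).comp (ContinuousLinearMap.snd ℝ ℝ ℝ³)).smulRight (e₂ 0) +
    ((EuclideanSpace.proj 1).comp (ContinuousLinearMap.snd ℝ ℝ ℝ³)).smulRight (e₂ 1)

/-- Coordinates of `P₂ (t, y) = (y₀, y₁)`. [folklore] -/
@[simp] theorem P₂_apply (z : ℝ × ℝ³) (i : Fin 2) : P₂ z i = z.2 0 * (e₂ 0) i + z.2 1 * (e₂ 1) i := by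
  simp [P₂]

/-- Factorisation of the pieces through the compactly supported planar profile. [folklore] -/
theorem F_eq (n : ℕ) : F n = fun z => α n • F₂ (((n : ℝ) • P₂) z) := by
  funext z
  ext i
  fin_cases i <;> simp [F, Vn, V_apply, φ, F₂, q] <;> ring

/-- The planar profile is supported in the closed disc of radius `2`. [folklore] -/
theorem hasCompactSupport_F₂ : HasCompactSupport F₂ := by
  refine HasCompactSupport.intro (isCompact_closedBall (0 : ℝ²) 2) fun v hv => ?_
  have hv' : 2 < ‖v‖ := by simpa using hv
  have h4 : 4 ≤ v 0 ^ 2 + v 1 ^ 2 := by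
    have : ‖v‖ ^ 2 = v 0 ^ 2 + v 1 ^ 2 := by
      rw [EuclideanSpace.real_norm_sq_eq, Fin.sum_univ_two]
    nlinarith
  simp [F₂, g_eq_zero_of_four_le h4]

/-- Every iterated derivative of the compactly supported planar profile is bounded. [folklore] -/
theorem iteratedFDeriv_F₂_bound (k : ℕ) : ∃ C, ∀ v, ‖iteratedFDeriv ℝ k F₂ v‖ ≤ C :=
  (F₂_contDiff.continuous_iteratedFDeriv (by exact_mod_cast le_top)).bounded_above_of_compact_support
    (hasCompactSupport_F₂.iteratedFDeriv k)

/-- `‖Dᵏ(F n)‖ ≤ αₙ nᵏ C_k` uniformly on space-time. [folklore] -/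
theorem norm_iteratedFDeriv_F_le (k : ℕ) :
    ∃ C, 0 ≤ C ∧ ∀ (n : ℕ) (z : ℝ × ℝ³), ‖iteratedFDeriv ℝ k (F n) z‖ ≤ α n * (n : ℝ) ^ k * C := by
  obtain ⟨C₀, hC₀⟩ := iteratedFDeriv_F₂_bound k
  have hC₀' : 0 ≤ C₀ := (norm_nonneg _).trans (hC₀ 0)
  refine ⟨C₀ * ‖P₂‖ ^ k, by positivity, fun n z => ?_⟩
  set L : ℝ × ℝ³ →L[ℝ] ℝ² := (n : ℝ) • P₂ with hL
  have hcomp : ContDiff ℝ ∞ (F₂ ∘ L) := F₂_contDiff.comp L.contDiff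
  have e1 : iteratedFDeriv ℝ k (F n) z = α n • iteratedFDeriv ℝ k (F₂ ∘ L) z := by
    rw [F_eq n]
    exact iteratedFDeriv_const_smul_apply' (hcomp.contDiffAt.of_le (by exact_mod_cast le_top))
  have e2 : iteratedFDeriv ℝ k (F₂ ∘ L) z =
      (iteratedFDeriv ℝ k F₂ (L z)).compContinuousLinearMap fun _ => L :=
    L.iteratedFDeriv_comp_right F₂_contDiff z (by exact_mod_cast le_top)
  have hLn : ‖L‖ = (n : ℝ) * ‖P₂‖ := by
    rw [hL, norm_smul, Real.norm_natCast]
  rw [e1, e2, norm_smul, Real.norm_of_nonneg (α_pos n).le]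
  calc α n * ‖(iteratedFDeriv ℝ k F₂ (L z)).compContinuousLinearMap fun _ => L‖
      ≤ α n * (‖iteratedFDeriv ℝ k F₂ (L z)‖ * ∏ _i : Fin k, ‖L‖) :=
        mul_le_mul_of_nonneg_left (ContinuousMultilinearMap.norm_compContinuousLinearMap_le _ _)
          (α_pos n).le
    _ ≤ α n * (C₀ * ∏ _i : Fin k, ‖L‖) := by
        gcongr
        · exact (α_pos n).le
        · exact hC₀ _
    _ = α n * (n : ℝ) ^ k * (C₀ * ‖P₂‖ ^ k) := by
        rw [Finset.prod_const, Finset.card_univ, Fintype.card_fin, hLn]; ring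

/-- Off the shell `1 ≤ n |ρ y| ≤ 2` all derivatives of `F n` vanish. [folklore] -/
theorem tsupport_F_subset (n : ℕ) :
    tsupport (F n) ⊆ {z | 1 ≤ (n : ℝ) ^ 2 * q z.2 ∧ (n : ℝ) ^ 2 * q z.2 ≤ 4} := by
  refine closure_minimal (fun z hz => ?_) ?_
  · have hg : g ((n : ℝ) ^ 2 * q z.2) ≠ 0 := by
      intro h0
      apply hz
      simp [F, Vn, V_apply, φ, h0]
    obtain ⟨h1, h4⟩ := g_ne_zero_imp hg
    exact ⟨h1.le, h4.le⟩
  · have hc : Continuous fun z : ℝ × ℝ³ => (n : ℝ) ^ 2 * q z.2 :=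
      continuous_const.mul (q_contDiff.continuous.comp continuous_snd)
    exact isClosed_Icc.preimage hc

/-- A point where some iterated derivative of `F n` is nonzero lies over the shell `1 ≤ n |ρ y| ≤ 2`. [folklore] -/
theorem shell_of_iteratedFDeriv_ne_zero {k n : ℕ} {z : ℝ × ℝ³}
    (hz : iteratedFDeriv ℝ k (F n) z ≠ 0) :
    1 ≤ (n : ℝ) * ‖ρ z.2‖ ∧ (n : ℝ) * ‖ρ z.2‖ ≤ 2 := by
  obtain ⟨h1, h4⟩ := tsupport_F_subset n (support_iteratedFDeriv_subset k (Function.mem_support.2 hz))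
  have hsq : ((n : ℝ) * ‖ρ z.2‖) ^ 2 = (n : ℝ) ^ 2 * q z.2 := by rw [mul_pow, norm_ρ_sq]
  have hnn : 0 ≤ (n : ℝ) * ‖ρ z.2‖ := by positivity
  constructor
  · refine (pow_le_pow_iff_left₀ zero_le_one hnn two_ne_zero).1 ?_
    rw [one_pow, hsq]; exact h1
  · refine (pow_le_pow_iff_left₀ hnn zero_le_two two_ne_zero).1 ?_
    rw [hsq]; norm_num; exact h4

/-- For a fixed base point `y₀`: eventually in `n`, the shell of piece `n` keeps distance
`≥ 1/n` from `y₀`. [folklore] -/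
theorem eventually_dist (y₀ : ℝ³) : ∃ N : ℕ, ∀ n, N ≤ n → ∀ y : ℝ³,
    1 ≤ (n : ℝ) * ‖ρ y‖ → (n : ℝ) * ‖ρ y‖ ≤ 2 → 1 ≤ (n : ℝ) * ‖y - y₀‖ := by
  have hρ : ∀ y, ‖ρ y - ρ y₀‖ ≤ ‖y - y₀‖ := fun y => by
    rw [← map_sub]; exact norm_ρ_le _
  by_cases h0 : ρ y₀ = 0
  · refine ⟨0, fun n _ y h1 _ => ?_⟩
    have : ‖ρ y‖ ≤ ‖y - y₀‖ := by simpa [h0] using hρ y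
    exact h1.trans (mul_le_mul_of_nonneg_left this (Nat.cast_nonneg n))
  · have hr : 0 < ‖ρ y₀‖ := norm_pos_iff.2 h0
    obtain ⟨N, hN⟩ := exists_nat_gt (6 / ‖ρ y₀‖)
    refine ⟨N, fun n hn y _ h2 => ?_⟩
    have hn6 : 6 ≤ (n : ℝ) * ‖ρ y₀‖ := by
      have : 6 / ‖ρ y₀‖ ≤ n := hN.le.trans (by exact_mod_cast hn)
      rwa [div_le_iff₀ hr] at this
    have htri : ‖ρ y₀‖ - ‖ρ y‖ ≤ ‖y - y₀‖ := by
      have h3 := norm_sub_norm_le (ρ y₀) (ρ y)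
      rw [norm_sub_rev] at h3
      linarith [hρ y]
    have := mul_le_mul_of_nonneg_left htri (Nat.cast_nonneg n)
    nlinarith

/-! ### Joint smoothness of the velocity within `S × ℝ³` -/

open Classical in
/-- The formal Taylor series of `uncurry u` within `S × ℝ³`: that of `F n` over the piece `n`,
zero over non-positive times. [folklore] -/
def Pser (z : ℝ × ℝ³) : FormalMultilinearSeries ℝ (ℝ × ℝ³) ℝ³ :=
  if hz : ∃ n, z.1 ∈ piece n then ftaylorSeries ℝ (F (Classical.choose hz)) z else 0

/-- Over piece `n`, `Pser` is the Taylor series of `F n`. [folklore] -/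
theorem Pser_of_mem {n : ℕ} {z : ℝ × ℝ³} (hz : z.1 ∈ piece n) : Pser z = ftaylorSeries ℝ (F n) z := by
  have hex : ∃ m, z.1 ∈ piece m := ⟨n, hz⟩
  rw [Pser, dif_pos hex, piece_unique (Classical.choose_spec hex) hz]

/-- Off the pieces, `Pser = 0`. [folklore] -/
theorem Pser_of_not {z : ℝ × ℝ³} (hz : ∀ n, z.1 ∉ piece n) : Pser z = 0 := by
  rw [Pser, dif_neg (by push Not; exact hz)]

/-- At non-positive times, `Pser = 0`. [folklore] -/
theorem Pser_of_nonpos {z : ℝ × ℝ³} (hz : z.1 ≤ 0) : Pser z = 0 :=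
  Pser_of_not (not_mem_piece_of_nonpos hz)

/-- `F n` has its Taylor series `ftaylorSeries ℝ (F n)` to all orders (it is smooth). [folklore] -/
theorem hasFTaylorSeries_F (n : ℕ) : HasFTaylorSeriesUpTo ∞ (F n) (ftaylorSeries ℝ (F n)) :=
  contDiff_iff_ftaylorSeries.1 (F_contDiff n)

/-- Over piece `n`, `uncurry u = F n`. [folklore] -/
theorem uncurry_u_of_mem {n : ℕ} {z : ℝ × ℝ³} (hz : z.1 ∈ piece n) : uncurry u z = F n z := by
  obtain ⟨t, y⟩ := z
  simp only [uncurry_apply_pair, F]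
  rw [u_of_mem hz]

/-- At non-positive times, `uncurry u = 0`. [folklore] -/
theorem uncurry_u_of_nonpos {z : ℝ × ℝ³} (hz : z.1 ≤ 0) : uncurry u z = 0 := by
  obtain ⟨t, y⟩ := z
  simp only [uncurry_apply_pair]
  rw [u_of_nonpos hz]; rfl

/-- Near a point of `S × ℝ³` over a piece, space-time points of `S × ℝ³` lie over the same piece. [folklore] -/
theorem eventually_mem_piece {n : ℕ} {z : ℝ × ℝ³} (hz : z.1 ∈ piece n) :
    ∀ᶠ z' in 𝓝[S ×ˢ (univ : Set ℝ³)] z, z'.1 ∈ piece n := by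
  have h1 : ∀ᶠ z' in 𝓝 z, z'.1 ∈ Ioo (z.1 - h n / 2) (z.1 + h n / 2) :=
    continuousAt_fst.preimage_mem_nhds
      (Ioo_mem_nhds (by linarith [h_pos n]) (by linarith [h_pos n]))
  rw [eventually_nhdsWithin_iff]
  filter_upwards [h1] with z' hz' hmem
  exact piece_isolated hz hmem.1 (abs_lt.2 ⟨by linarith [hz'.1], by linarith [hz'.2]⟩)

/-- Near a space-time point of negative time, times are negative. [folklore] -/
theorem eventually_neg {z : ℝ × ℝ³} (hz : z.1 < 0) : ∀ᶠ z' in 𝓝 z, z'.1 < 0 :=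
  continuousAt_fst.preimage_mem_nhds (Iio_mem_nhds hz)

/-- **Key estimate at the accumulation time `t = 0`**: near `(0, y₀)` within `S × ℝ³` the terms
of `Pser` are `o(|z - (0, y₀)|)` and tend to `0`. [folklore] -/
theorem key_estimate (k : ℕ) (y₀ : ℝ³) {c : ℝ} (hc : 0 < c) :
    ∀ᶠ z in 𝓝[S ×ˢ (univ : Set ℝ³)] ((0 : ℝ), y₀),
      ‖Pser z k‖ ≤ c * ‖z - (0, y₀)‖ ∧ ‖Pser z k‖ ≤ c := by
  obtain ⟨C, hC0, hC⟩ := norm_iteratedFDeriv_F_le k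
  obtain ⟨N₁, hN₁⟩ := eventually_dist y₀
  have hlim : Tendsto (fun n : ℕ => (n : ℝ) ^ (k + 1) * (1 / 10) ^ n * C) atTop (𝓝 0) := by
    simpa using (tendsto_pow_const_mul_const_pow_of_lt_one (k + 1)
      (by norm_num : (0 : ℝ) ≤ 1 / 10) (by norm_num)).mul_const C
  obtain ⟨N₂, hN₂⟩ := eventually_atTop.1 (hlim.eventually (Iio_mem_nhds hc))
  set N := max (max N₁ N₂) 1 with hNdef
  have hnhds : ∀ᶠ z in 𝓝 ((0 : ℝ), y₀), z.1 < h N :=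
    continuousAt_fst.preimage_mem_nhds (Iio_mem_nhds (h_pos N))
  rw [eventually_nhdsWithin_iff]
  filter_upwards [hnhds] with z hz1 hzS
  obtain ⟨ht, -⟩ := hzS
  rcases mem_S_cases ht with ht0 | ⟨n, hn⟩
  · rw [Pser_of_nonpos ht0]
    simp only [FormalMultilinearSeries.zero_apply, norm_zero]
    exact ⟨by positivity, hc.le⟩
  · have hNn : N < n := lt_of_mem_piece_of_lt hn hz1
    have hn1 : (1 : ℝ) ≤ n := by exact_mod_cast le_trans (le_max_right _ _) hNn.le
    have hN₁n : N₁ ≤ n := le_trans ((le_max_left _ _).trans (le_max_left _ _)) hNn.le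
    have hN₂n : N₂ ≤ n := le_trans ((le_max_right _ _).trans (le_max_left _ _)) hNn.le
    have hdec : (n : ℝ) ^ (k + 1) * (1 / 10) ^ n * C < c := hN₂ n hN₂n
    rw [Pser_of_mem hn]
    change ‖iteratedFDeriv ℝ k (F n) z‖ ≤ _ ∧ ‖iteratedFDeriv ℝ k (F n) z‖ ≤ _
    have hb := hC n z
    have hαn : α n * (n : ℝ) ^ k * C ≤ (n : ℝ) ^ (k + 1) * (1 / 10) ^ n * C := by
      have : α n * (n : ℝ) ^ k * C * 1 ≤ α n * (n : ℝ) ^ k * C * n :=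
        mul_le_mul_of_nonneg_left hn1 (by have := α_pos n; positivity)
      calc α n * (n : ℝ) ^ k * C = α n * (n : ℝ) ^ k * C * 1 := by ring
        _ ≤ α n * (n : ℝ) ^ k * C * n := this
        _ = (n : ℝ) ^ (k + 1) * (1 / 10) ^ n * C := by simp only [α]; ring
    refine ⟨?_, hb.trans (hαn.trans hdec.le)⟩
    by_cases hzero : iteratedFDeriv ℝ k (F n) z = 0
    · rw [hzero, norm_zero]; positivity
    · obtain ⟨h1, h2⟩ := shell_of_iteratedFDeriv_ne_zero hzero
      have hdist : 1 ≤ (n : ℝ) * ‖z.2 - y₀‖ := hN₁ n hN₁n z.2 h1 h2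
      have hzz : ‖z.2 - y₀‖ ≤ ‖z - (0, y₀)‖ := by
        have := norm_snd_le (z - ((0 : ℝ), y₀))
        simpa using this
      calc ‖iteratedFDeriv ℝ k (F n) z‖ ≤ α n * (n : ℝ) ^ k * C := hb
        _ ≤ α n * (n : ℝ) ^ k * C * ((n : ℝ) * ‖z.2 - y₀‖) :=
            le_mul_of_one_le_right (by have := α_pos n; positivity) hdist
        _ = (n : ℝ) ^ (k + 1) * (1 / 10) ^ n * C * ‖z.2 - y₀‖ := by simp only [α]; ring
        _ ≤ c * ‖z.2 - y₀‖ := mul_le_mul_of_nonneg_right hdec.le (norm_nonneg _)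
        _ ≤ c * ‖z - (0, y₀)‖ := mul_le_mul_of_nonneg_left hzz hc.le

/-- Currying the zero multilinear map gives zero. [folklore] -/
theorem curryLeft_zero (k : ℕ) :
    (0 : ContinuousMultilinearMap ℝ (fun _ : Fin (k + 1) => ℝ × ℝ³) ℝ³).curryLeft = 0 :=
  ContinuousLinearMap.ext fun v => ContinuousMultilinearMap.ext fun m => by
    simp [ContinuousMultilinearMap.curryLeft_apply]

/-- The formal Taylor expansion of `uncurry u` within `S × ℝ³`, to every finite order. [folklore] -/
theorem hasFTaylorSeries_u (m : ℕ) :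
    HasFTaylorSeriesUpToOn m (uncurry u) Pser (S ×ˢ (univ : Set ℝ³)) := by
  constructor
  · -- the zeroth term
    rintro z ⟨ht, -⟩
    rcases mem_S_cases ht with ht0 | ⟨n, hn⟩
    · rw [Pser_of_nonpos ht0, uncurry_u_of_nonpos ht0]
      simp
    · rw [Pser_of_mem hn, uncurry_u_of_mem hn]
      exact (hasFTaylorSeries_F n).zero_eq z
  · -- the derivatives
    intro k hk z hz
    obtain ⟨ht, -⟩ := hz
    rcases lt_trichotomy z.1 0 with hneg | h0 | hpos
    · have hev : ∀ᶠ z' in 𝓝[S ×ˢ (univ : Set ℝ³)] z, (fun z' => Pser z' k) z' = (fun _ => 0) z' := by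
        filter_upwards [mem_nhdsWithin_of_mem_nhds (eventually_neg hneg)] with z' hz'
        simp [Pser_of_nonpos (le_of_lt hz')]
      rw [Pser_of_nonpos hneg.le]
      simp only [FormalMultilinearSeries.zero_apply, curryLeft_zero]
      exact (hasFDerivWithinAt_const (0 : ContinuousMultilinearMap ℝ (fun _ : Fin k => ℝ × ℝ³) ℝ³)
        z _).congr_of_eventuallyEq hev (by simp [Pser_of_nonpos hneg.le])
    · -- the accumulation time
      obtain ⟨t, y⟩ := z
      simp only at h0
      subst h0
      have hP0 : Pser ((0 : ℝ), y) = 0 := Pser_of_nonpos le_rfl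
      rw [hP0]
      simp only [FormalMultilinearSeries.zero_apply, curryLeft_zero]
      refine hasFDerivWithinAt_iff_isLittleO.2 (Asymptotics.isLittleO_iff.2 fun c hc => ?_)
      filter_upwards [key_estimate k y hc] with z hz
      simpa [hP0] using hz.1
    · obtain ⟨n, hn⟩ := exists_piece_of_pos ht hpos
      have hev : ∀ᶠ z' in 𝓝[S ×ˢ (univ : Set ℝ³)] z,
          (fun z' => Pser z' k) z' = (fun z' => ftaylorSeries ℝ (F n) z' k) z' :=
        (eventually_mem_piece hn).mono fun z' hz' => by simp only [Pser_of_mem hz']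
      rw [Pser_of_mem hn]
      exact (((hasFTaylorSeries_F n).fderiv k (by exact_mod_cast ENat.coe_lt_top k)
        z).hasFDerivWithinAt).congr_of_eventuallyEq hev (by simp only [Pser_of_mem hn])
  · -- continuity of the terms
    intro k hk z hz
    obtain ⟨ht, -⟩ := hz
    rcases lt_trichotomy z.1 0 with hneg | h0 | hpos
    · have hev : ∀ᶠ z' in 𝓝[S ×ˢ (univ : Set ℝ³)] z, (fun z' => Pser z' k) z' = (fun _ => 0) z' := by
        filter_upwards [mem_nhdsWithin_of_mem_nhds (eventually_neg hneg)] with z' hz'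
        simp [Pser_of_nonpos (le_of_lt hz')]
      exact (continuousWithinAt_const (b := (0 : ContinuousMultilinearMap ℝ
        (fun _ : Fin k => ℝ × ℝ³) ℝ³))).congr_of_eventuallyEq hev
          (by simp [Pser_of_nonpos hneg.le])
    · obtain ⟨t, y⟩ := z
      simp only at h0
      subst h0
      have hP0 : Pser ((0 : ℝ), y) = 0 := Pser_of_nonpos le_rfl
      show Tendsto (fun z' => Pser z' k) (𝓝[S ×ˢ univ] ((0 : ℝ), y)) (𝓝 (Pser ((0 : ℝ), y) k))
      rw [hP0, FormalMultilinearSeries.zero_apply]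
      refine NormedAddGroup.tendsto_nhds_zero.2 fun ε hε => ?_
      filter_upwards [key_estimate k y (half_pos hε)] with z hz
      linarith [hz.2]
    · obtain ⟨n, hn⟩ := exists_piece_of_pos ht hpos
      have hev : ∀ᶠ z' in 𝓝[S ×ˢ (univ : Set ℝ³)] z,
          (fun z' => Pser z' k) z' = (fun z' => ftaylorSeries ℝ (F n) z' k) z' :=
        (eventually_mem_piece hn).mono fun z' hz' => by simp only [Pser_of_mem hz']
      exact (((hasFTaylorSeries_F n).cont k (by exact_mod_cast le_top)).continuousAt
        |>.continuousWithinAt).congr_of_eventuallyEq hev (by simp only [Pser_of_mem hn])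

/-- **The velocity is jointly `C^∞` within `S × ℝ³`.** [folklore] -/
theorem isSmoothSpaceTimeOn_u : IsSmoothSpaceTimeOn S u :=
  contDiffOn_infty.2 fun m => (hasFTaylorSeries_u m).contDiffOn

/-! ### The velocity solves the vorticity formulation on `S` -/

/-- **`u` is a solution of the vorticity formulation (Euler, `ν = 0`) on the time set `S`.** [folklore] -/
theorem isVorticitySolutionOn_u : IsVorticitySolutionOn S 0 u where
  smooth_velocity := isSmoothSpaceTimeOn_u
  vorticity_eq t ht x := by
    have h1 : timeDerivWithin S (vorticity u) t x = 0 := by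
      rw [timeDerivWithin_apply]
      simp only [vorticity_apply]
      exact derivWithin_curl_u_eq_zero ht x
    rw [h1, zero_add, vorticity_apply]
    by_cases hex : ∃ n, t ∈ piece n
    · obtain ⟨n, hn⟩ := hex
      rw [u_of_mem hn]
      exact convect_curl_V (φ_contDiff n) (Ψ_contDiff n) (hasDerivAt_Ψ n) x
    · push Not at hex
      rw [u_of_not hex]
      have hc : curl (0 : ℝ³ → ℝ³) = 0 := funext fun y => curl_zero y
      simp [hc, convect]
  divFree t _ := isDivFree_u t

/-! ### No pressure exists -/

/-- The observation point `x* = (0, 3, 0)` beyond all shells. [folklore] -/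
def xs : ℝ³ := EuclideanSpace.single 1 3

/-- **No jointly smooth pressure makes `u` a classical solution on `S`.** The pressure
difference `π(t) = p(t, x*) - p(t, 0)` vanishes for `t ≤ 0`, equals the centripetal pressure
drop `≥ hₙ / 2` at `t = hₙ`, and would have to be differentiable within `S` at `t = 0`. [folklore] -/
theorem no_pressure (p : ℝ → ℝ³ → ℝ) (hp : IsClassicalNSSolutionOn S 0 0 u p) : False := by
  set π : ℝ → ℝ := fun t => p t xs - p t 0 with hπ
  -- (a) `π = 0` at non-positive times: the pressure gradient vanishes there
  have hπ_nonpos : ∀ t ∈ S, t ≤ 0 → π t = 0 := by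
    intro t ht ht0
    have hd : Differentiable ℝ (p t) := (hp.contDiff_pressure ht).differentiable (by simp)
    have hf : ∀ x, fderiv ℝ (p t) x = 0 := fun x => by
      have hm := hp.momentum t ht x
      rw [timeDerivWithin_apply, derivWithin_u_eq_zero ht x, u_of_nonpos ht0] at hm
      have hg : gradient (p t) x = 0 := by simpa [convect] using hm
      unfold gradient at hg
      exact (InnerProductSpace.toDual ℝ ℝ³).symm.map_eq_zero_iff.1 hg
    have := is_const_of_fderiv_eq_zero hd hf xs 0
    simp [hπ, this]
  -- (b) `π (h n) ≥ h n / 2`: comparison with the explicit centripetal pressure `Pn n`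
  have hπ_piece : ∀ n, 1 ≤ n → h n / 2 ≤ π (h n) := by
    intro n hn
    have ht : h n ∈ piece n := h_mem_piece n
    have htS : h n ∈ S := piece_subset_S n ht
    have hd1 : Differentiable ℝ (p (h n)) := (hp.contDiff_pressure htS).differentiable (by simp)
    have hd2 : Differentiable ℝ (Pn n) :=
      ((Ψ_contDiff n).comp q_contDiff).differentiable (by simp)
    have hgrad : ∀ x, gradient (p (h n)) x = gradient (Pn n) x := fun x => by
      have hm := hp.momentum (h n) htS x
      rw [timeDerivWithin_apply, derivWithin_u_eq_zero htS x, u_of_mem ht, zero_add, Vn,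
        convect_V (φ_contDiff n)] at hm
      have e2 : gradient (Pn n) x = (φ n (q x)) ^ 2 • ρ x := gradient_P (hasDerivAt_Ψ n) x
      rw [e2]
      have hm' : -(φ n (q x) ^ 2 • ρ x) = -gradient (p (h n)) x := by simpa using hm
      exact (neg_injective hm').symm
    have hf : ∀ x, fderiv ℝ (fun y => p (h n) y - Pn n y) x = 0 := fun x => by
      rw [fderiv_fun_sub (hd1 x) (hd2 x)]
      have hg := hgrad x
      unfold gradient at hg
      rw [(InnerProductSpace.toDual ℝ ℝ³).symm.injective hg, sub_self]
    have hc := is_const_of_fderiv_eq_zero (hd1.sub hd2) hf xs 0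
    have hP := Pn_star_sub_Pn_zero n hn
    simp only [hπ]
    simp only [Pi.sub_apply] at hc
    rw [xs] at hc ⊢
    linarith
  -- (c) `π` is differentiable within `S` at `0`, with derivative `0` (from the left)
  have h0S : (0 : ℝ) ∈ S := zero_mem_S
  have hdiff : DifferentiableWithinAt ℝ π S 0 :=
    (hp.smooth_pressure.differentiableWithinAt_time h0S xs).sub
      (hp.smooth_pressure.differentiableWithinAt_time h0S 0)
  have hder : HasDerivWithinAt π (derivWithin π S 0) S 0 := hdiff.hasDerivWithinAt
  have hL : derivWithin π S 0 = 0 := by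
    have h1 : HasDerivWithinAt π (derivWithin π S 0) (Iic 0) 0 := hder.mono subset_union_left
    have h2 : HasDerivWithinAt π 0 (Iic 0) 0 := by
      refine (hasDerivWithinAt_const (0 : ℝ) (Iic 0) (0 : ℝ)).congr_of_eventuallyEq ?_ ?_
      · filter_upwards [self_mem_nhdsWithin] with t ht
        exact hπ_nonpos t (Or.inl ht) ht
      · exact hπ_nonpos 0 h0S le_rfl
    exact (uniqueDiffOn_Iic (0 : ℝ) 0 self_mem_Iic).eq_deriv _ h1 h2
  rw [hL] at hder
  -- (d) but the slopes along `hₙ → 0⁺` are `≥ 1/2`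
  have htend : Tendsto (slope π 0) (𝓝[S \ {0}] 0) (𝓝 0) :=
    hasDerivWithinAt_iff_tendsto_slope.1 hder
  have hseq : Tendsto h atTop (𝓝[S \ {0}] 0) := by
    refine tendsto_nhdsWithin_iff.2 ⟨?_, Filter.Eventually.of_forall fun n =>
      ⟨piece_subset_S n (h_mem_piece n), (h_pos n).ne'⟩⟩
    exact tendsto_pow_atTop_nhds_zero_of_lt_one (by norm_num) (by norm_num)
  have hlim := htend.comp hseq
  have hev : ∀ᶠ n in atTop, (1 / 2 : ℝ) ≤ (slope π 0 ∘ h) n := by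
    filter_upwards [Filter.eventually_ge_atTop 1] with n hn
    simp only [Function.comp_apply, slope_def_field, hπ_nonpos 0 h0S le_rfl, sub_zero]
    rw [le_div_iff₀ (h_pos n)]
    linarith [hπ_piece n hn]
  have := ge_of_tendsto hlim hev
  linarith

/-- The instance `(S, ν = 0, u)` of the named fact `isVorticitySolutionOn_iff` of
`NSVorticity.lean` — its `def` body verbatim at these arguments, so that the name is not used —
is false. [folklore] -/
theorem not_isVorticitySolutionOn_iff_instance :
    ¬ ∀ (hS : UniqueDiffOn ℝ S),
      IsVorticitySolutionOn S 0 u ↔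
        ∃ p : ℝ → ℝ³ → ℝ, IsClassicalNSSolutionOn S 0 0 u p := fun H =>
  let ⟨p, hp⟩ := (H uniqueDiffOn_S).1 isVorticitySolutionOn_u
  no_pressure p hp

/-- The instance `(S, ν = 0, u)` of the named fact `IsVorticitySolutionOn.exists_pressure` of
`Vorticity.lean` — its `def` body verbatim at these arguments, so that the name is not used — is
false. [folklore] -/
theorem not_exists_pressure_instance :
    ¬ ∀ (h : IsVorticitySolutionOn S 0 u) (hS : UniqueDiffOn ℝ S),
      ∃ p : ℝ → ℝ³ → ℝ, IsClassicalNSSolutionOn S 0 0 u p := fun H =>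
  let ⟨p, hp⟩ := H isVorticitySolutionOn_u uniqueDiffOn_S
  no_pressure p hp

end VorticityIffCex

/-- Local notation for physical space `ℝ³ = EuclideanSpace ℝ (Fin 3)`. -/
local notation "ℝ³" => EuclideanSpace ℝ (Fin 3)

/-- **Refutation of `isVorticitySolutionOn_iff` as stated** (for *every* time set of unique
differentiability): on `S = (-∞, 0] ∪ ⋃ₙ [100⁻ⁿ, 2·100⁻ⁿ]` the velocity equal to the steady planar
Euler swirl `10⁻ⁿ n g(n²(y₀² + y₁²)) (-y₁, y₀, 0)` on the `n`-th piece and to `0` elsewhere is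
jointly `C^∞` within `S × ℝ³`, divergence free and solves the vorticity formulation with `ν = 0`,
but admits no jointly smooth pressure: the centripetal pressure drop between the axis and
`x* = (0, 3, 0)` is `≥ 100⁻ⁿ / 2` at time `100⁻ⁿ` and `0` at non-positive times, so
`t ↦ p(t, x*) - p(t, 0)` is not differentiable within `S` at `t = 0`. The refuted proposition is
the body of the named fact `isVorticitySolutionOn_iff` of `NSVorticity.lean`, reproduced
verbatim and closed over its section-implicit arguments `S ν u` (so that the refuted `def` can be
retired from the named-fact registry — D-0026 verdict clean-up, 2026-08-15 — without touching
this file); the corrected statement (convex `S`) is `isVorticitySolutionOn_iff_of_convex_holds`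
(`NSVorticityProofs.lean`). [folklore] -/
theorem not_isVorticitySolutionOn_iff :
    ¬ ∀ (S : Set ℝ) (ν : ℝ) (u : ℝ → ℝ³ → ℝ³),
      ∀ (hS : UniqueDiffOn ℝ S),
        IsVorticitySolutionOn S ν u ↔
          ∃ p : ℝ → ℝ³ → ℝ, IsClassicalNSSolutionOn S ν 0 u p := fun H =>
  VorticityIffCex.not_isVorticitySolutionOn_iff_instance (H _ _ _)

/-- The same example refutes the sibling named fact `IsVorticitySolutionOn.exists_pressure` of
`Vorticity.lean` (vorticity ⇒ velocity formulation for *every* time set of unique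
differentiability) in its stated generality. The refuted proposition is that `def`'s body,
reproduced verbatim and closed over its section-implicit arguments `S ν u` (so that the refuted
`def` can be retired from the named-fact registry — D-0026 verdict clean-up, 2026-08-15 —
without touching this file); the corrected statement (convex `S`, i.e. the source's time interval:
Majda–Bertozzi 2002, §2.4.4, proof of Prop. 2.21, p. 70 of the held text) is the proved
`IsVorticitySolutionOn.exists_pressure_of_convex` (`NSVorticityProofs.lean`). [folklore] -/
theorem not_isVorticitySolutionOn_exists_pressure :
    ¬ ∀ (S : Set ℝ) (ν : ℝ) (u : ℝ → ℝ³ → ℝ³),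
      ∀ (h : IsVorticitySolutionOn S ν u) (hS : UniqueDiffOn ℝ S),
        ∃ p : ℝ → ℝ³ → ℝ, IsClassicalNSSolutionOn S ν 0 u p := fun H =>
  VorticityIffCex.not_exists_pressure_instance (H _ _ _)

/-- Existential form: a time set of unique differentiability and an Euler vorticity solution on it
without any classical pressure. [folklore] -/
theorem exists_isVorticitySolutionOn_not_exists_pressure :
    ∃ (S : Set ℝ) (u : ℝ → ℝ³ → ℝ³), UniqueDiffOn ℝ S ∧ IsVorticitySolutionOn S 0 u ∧
      ¬ ∃ p : ℝ → ℝ³ → ℝ, IsClassicalNSSolutionOn S 0 0 u p :=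
  ⟨VorticityIffCex.S, VorticityIffCex.u, VorticityIffCex.uniqueDiffOn_S,
    VorticityIffCex.isVorticitySolutionOn_u, fun ⟨p, hp⟩ => VorticityIffCex.no_pressure p hp⟩


end Literature.Analysis.FluidPDE
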